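import Summits.Ventures.Crystal3D.TopCut.CapSOSCheck
import HarnessLib

/-!
# Cap-cut certificates by sum-of-squares identities: SOUNDNESS

Venture `Crystal3D` (cell `pub-crystal3d`, phase 2; seat p2). Soundness of the checker of
`TopCut/CapSOSCheck.lean`: an `SOSCert` whose kernel expansion is valid (`CapFValid`), whose seven
Gram expansions are valid (`RValid`, from `ThreePointCert.CheckKron` chunk checks), and which passes
`bridge`, `check1`, `check2`, `side1`, `side2`, proves the two polynomial inequalities of a
Bachoc–Vallentin cap certificate `c : CapCert` —
`ineqI_of_capSOS : c.IneqI D` and `ineqII_of_capSOS : c.IneqII (1/2) lam` — hence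
`capCodeBound_of_capSOS : CapCodeBound c.u₀` through `CapCut.capCodeBound_of_capCert` (seat p3) and
`NoHole (-u₀)` by `noHole_of_capCodeBound`. On `Δ` every multiplier (`m_u`, `m_v`, `m_u + m_v`,
`m_u m_v`, `(1+t)(1-2t)`, `1 + 2uvt - u² - v² - t²`) is nonnegative, every Gram form is `≥ 0`, the
residual is bounded by the slack on the unit box (`PolyCert.abs_eval_le_of_residualBound`), and the
dyadic bridge transfers the bound from `K'` to `K`. [cite: BachocVallentin2009, Theorem 4.4]
HONEST FRAMING: soundness only; no certificate is asserted here.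
-/

noncomputable section

open Finset
open Literature.Geometry.DiscreteGeometry Literature.Geometry.DiscreteGeometry.PolyCert
open Literature.Geometry.DiscreteGeometry.PolyCert.SPoly
open Literature.Geometry.DiscreteGeometry.BachocVallentin
open Summit.Ventures.PackingBounds.ThreePointCert

namespace Summit.Ventures.Crystal3D.CapSOS

/-! ### Soundness -/

/-- `|u| ≤ 1` for `u ∈ [-p₀/q₀, 1]` with `p₀ ≤ q₀`, `0 < q₀`. [folklore] -/
theorem abs_le_one_of_cap (p0 q0 : ℕ) (hq : 0 < q0) (hpq : p0 ≤ q0) (u : ℝ)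
    (hu : -(p0 : ℝ) / q0 ≤ u) (hu' : u ≤ 1) : |u| ≤ 1 := by
  rw [abs_le]
  refine ⟨le_trans ?_ hu, hu'⟩
  have hq' : (0 : ℝ) < q0 := by exact_mod_cast hq
  have hpq' : (p0 : ℝ) ≤ q0 := by exact_mod_cast hpq
  rw [le_div_iff₀ hq']; linarith

/-- `m_u ≥ 0` on the cap interval. [folklore] -/
theorem mIu_nonneg (p0 q0 : ℕ) (hq : 0 < q0) (u : ℝ) (hu : -(p0 : ℝ) / q0 ≤ u) (hu' : u ≤ 1) :
    0 ≤ ((q0 : ℝ) * u + p0) * (1 - u) := by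
  have hq' : (0 : ℝ) < q0 := by exact_mod_cast hq
  have h1 : 0 ≤ (q0 : ℝ) * u + p0 := by
    rw [div_le_iff₀ hq'] at hu; linarith
  exact mul_nonneg h1 (by linarith)

/-- The bridge bound: `2^B0 · DK · K ≤ DK · K'⁽ˢᶜᵃˡᵉᵈ⁾ + delB` at any point of the unit box. [folklore] -/
theorem bridge_le (S : SOSCert) (c : CapCert) (L : CapLink) (DK : ℕ) (KI : SPoly)
    (hlink : linkCheck c L DK = true) (hKI : CapFValid (L.blocks c.L.length c.R) KI)
    (hb : S.bridge DK KI = true) (u v t : ℝ) (hu : |u| ≤ 1) (hv : |v| ≤ 1) (ht : |t| ≤ 1) :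
    (2 ^ S.B0 : ℝ) * ((DK : ℝ) * c.kernel u v t) ≤ (DK : ℝ) * eval S.KpI u v t + S.delB := by
  have h := abs_eval_le_of_residualBound _ _ hb hu hv ht
  rw [eval_append, eval_smul, eval_neg, eval_smul, hKI u v t hu hv ht, capFval_link c L DK hlink] at h
  push_cast at h
  have := (abs_le.1 h).2
  linarith

set_option maxHeartbeats 800000 in
/-- **Soundness of (II)**: an `SOSCert` passing `check2`, the bridge and the side conditions, with
validated Gram expansions and a validated kernel expansion, proves `c.IneqII (1/2) lam`.
[cite: BachocVallentin2009, Theorem 4.4 (c)] -/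
theorem ineqII_of_capSOS (c : CapCert) (L : CapLink) (DK : ℕ) (KI : SPoly) (S : SOSCert)
    (g0 g1 g2 g3 g4 : GramBlk) (lam : ℚ)
    (hlink : linkCheck c L DK = true) (hKI : CapFValid (L.blocks c.L.length c.R) KI)
    (h0 : RValid g0 S.E0) (h1 : RValid g1 S.E1) (h2 : RValid g2 S.E2) (h3 : RValid g3 S.E3)
    (h4 : RValid g4 S.E4) (hb : S.bridge DK KI = true) (hc : S.check2 = true)
    (hs : S.side2 c DK lam = true) : c.IneqII (1 / 2) lam := by
  simp only [SOSCert.side2, Bool.and_eq_true, decide_eq_true_eq] at hs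
  obtain ⟨⟨⟨⟨⟨hq, hpq⟩, hu0⟩, hDK⟩, hl2⟩, hlam⟩ := hs
  intro u v t hu hu' hv hv' ht ht' hgram
  have hu0R : ((c.u0 : ℚ) : ℝ) = -(S.p0 : ℝ) / S.q0 := by rw [hu0]; push_cast; ring
  rw [hu0R] at hu hv
  have hu1 := abs_le_one_of_cap S.p0 S.q0 hq hpq u hu hu'
  have hv1 := abs_le_one_of_cap S.p0 S.q0 hq hpq v hv hv'
  have ht1 : |t| ≤ 1 := abs_le.2 ⟨ht, by push_cast at ht'; linarith⟩
  have gu := mIu_nonneg S.p0 S.q0 hq u hu hu'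
  have gv := mIu_nonneg S.p0 S.q0 hq v hv hv'
  have gt : 0 ≤ (1 + t) * (1 - 2 * t) := mul_nonneg (by linarith) (by push_cast at ht'; linarith)
  have hres := abs_eval_le_of_residualBound _ _ hc hu1 hv1 ht1
  rw [eval_mergeAll] at hres
  simp only [List.map_cons, List.map_nil, List.sum_cons, List.sum_nil, add_zero, eval_neg, eval_C,
    Int.cast_natCast] at hres
  have hrhs : 0 ≤ eval S.rhs2 u v t := by
    have e0 := eval_nonneg_of_rvalid g0 S.E0 h0 u v t hu1 hv1 ht1
    have e1 := eval_nonneg_of_rvalid g1 S.E1 h1 u v t hu1 hv1 ht1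
    have e2 := eval_nonneg_of_rvalid g2 S.E2 h2 u v t hu1 hv1 ht1
    have e3 := eval_nonneg_of_rvalid g3 S.E3 h3 u v t hu1 hv1 ht1
    have e4 := eval_nonneg_of_rvalid g4 S.E4 h4 u v t hu1 hv1 ht1
    rw [SOSCert.rhs2, eval_mergeAll]
    simp only [List.map_cons, List.map_nil, List.sum_cons, List.sum_nil, add_zero, eval_mulN,
      eval_append, eval_permBAC, SOSCert.eval_mIu, eval_ptT, eval_p4]
    generalize eval S.E0 u v t = r0 at *
    generalize eval S.E1 u v t = r1 at *
    generalize eval S.E2 u v t = r2 at *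
    generalize eval S.E3 u v t = r3 at *
    generalize eval S.E4 u v t = r4 at *
    generalize ((S.q0 : ℝ) * u + S.p0) * (1 - u) = a1 at *
    generalize ((S.q0 : ℝ) * v + S.p0) * (1 - v) = a2 at *
    generalize (1 + t) * (1 - 2 * t) = a3 at *
    generalize 1 + 2 * u * v * t - u ^ 2 - v ^ 2 - t ^ 2 = a4 at *
    have p1 := mul_nonneg (add_nonneg gu gv) e1
    have p2 := mul_nonneg (mul_nonneg gu gv) e2
    have p3 := mul_nonneg gt e3
    have p4' := mul_nonneg hgram e4
    linarith
  have htgt : 0 ≤ eval S.target2 u v t := by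
    have := (abs_le.1 hres).1
    linarith
  rw [SOSCert.target2, eval_smul, eval_neg, eval_append, eval_C] at htgt
  push_cast at htgt
  have hl2' : (0 : ℝ) < S.lam2 := by exact_mod_cast hl2
  have hK' : eval S.KpI u v t ≤ -(S.LamD : ℝ) := by
    have h' : 0 ≤ (S.lam2 : ℝ) * (-(eval S.KpI u v t + (S.LamD : ℝ))) := by linarith
    have := (mul_nonneg_iff_of_pos_left hl2').1 h'
    linarith
  have hbr := bridge_le S c L DK KI hlink hKI hb u v t hu1 hv1 ht1
  have hDK' : (0 : ℝ) < DK := by exact_mod_cast hDK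
  have h2B : (0 : ℝ) < 2 ^ S.B0 := pow_pos (by norm_num) _
  have hlamR : (lam : ℝ) * ((DK : ℝ) * 2 ^ S.B0) ≤ (S.LamD : ℝ) * DK - S.delB := by
    have h' : ((lam * ((DK * 2 ^ S.B0 : ℕ) : ℚ) : ℚ) : ℝ) ≤
        ((((S.LamD * DK : ℕ) : ℚ) - S.delB : ℚ) : ℝ) := by
      exact_mod_cast hlam
    push_cast at h'
    exact h'
  have hDKK : (DK : ℝ) * eval S.KpI u v t ≤ (DK : ℝ) * (-(S.LamD : ℝ)) :=
    mul_le_mul_of_nonneg_left hK' hDK'.le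
  have key : c.kernel u v t * ((DK : ℝ) * 2 ^ S.B0) ≤ (-(lam : ℝ)) * ((DK : ℝ) * 2 ^ S.B0) := by
    have e1 : c.kernel u v t * ((DK : ℝ) * 2 ^ S.B0) = (2 ^ S.B0 : ℝ) * ((DK : ℝ) * c.kernel u v t) := by
      ring
    rw [e1]; linarith
  have hpos : (0 : ℝ) < (DK : ℝ) * 2 ^ S.B0 := mul_pos hDK' h2B
  have := le_of_mul_le_mul_right key hpos
  simpa using this

set_option maxHeartbeats 800000 in
/-- **Soundness of (I)**: an `SOSCert` passing `check1`, the bridge and the side conditions proves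
`c.IneqI D`. [cite: BachocVallentin2009, Theorem 4.4 (d)] -/
theorem ineqI_of_capSOS (c : CapCert) (L : CapLink) (DK : ℕ) (KI : SPoly) (S : SOSCert)
    (q0 q1 : GramBlk) (D : ℚ)
    (hlink : linkCheck c L DK = true) (hKI : CapFValid (L.blocks c.L.length c.R) KI)
    (hq0 : RValid q0 S.Q0) (hq1 : RValid q1 S.Q1) (hb : S.bridge DK KI = true)
    (hc : S.check1 = true) (hs : S.side1 c DK D = true) : c.IneqI D := by
  simp only [SOSCert.side1, Bool.and_eq_true, decide_eq_true_eq] at hs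
  obtain ⟨⟨⟨⟨⟨hq, hpq⟩, hu0⟩, hDK⟩, hl1⟩, hD⟩ := hs
  intro u hu hu'
  have hu0R : ((c.u0 : ℚ) : ℝ) = -(S.p0 : ℝ) / S.q0 := by rw [hu0]; push_cast; ring
  rw [hu0R] at hu
  have hu1 := abs_le_one_of_cap S.p0 S.q0 hq hpq u hu hu'
  have h11 : |(1 : ℝ)| ≤ 1 := by simp
  have gu := mIu_nonneg S.p0 S.q0 hq u hu hu'
  have hres := abs_eval_le_of_residualBound _ _ hc hu1 hu1 h11
  rw [eval_mergeAll] at hres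
  simp only [List.map_cons, List.map_nil, List.sum_cons, List.sum_nil, add_zero, eval_neg, eval_C,
    Int.cast_natCast] at hres
  have hrhs : 0 ≤ eval S.rhs1 u u 1 := by
    have e0 := eval_nonneg_of_rvalid q0 S.Q0 hq0 u u 1 hu1 hu1 h11
    have e1 := eval_nonneg_of_rvalid q1 S.Q1 hq1 u u 1 hu1 hu1 h11
    rw [SOSCert.rhs1, eval_mergeAll]
    simp only [List.map_cons, List.map_nil, List.sum_cons, List.sum_nil, add_zero, eval_mulN,
      SOSCert.eval_mIu]
    generalize eval S.Q0 u u 1 = r0 at *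
    generalize eval S.Q1 u u 1 = r1 at *
    generalize ((S.q0 : ℝ) * u + S.p0) * (1 - u) = a1 at *
    have p1 := mul_nonneg gu e1
    linarith
  have htgt : 0 ≤ eval S.target1 u u 1 := by
    have := (abs_le.1 hres).1
    linarith
  rw [SOSCert.target1, eval_smul, eval_append, eval_C, eval_neg, eval_substUU1] at htgt
  push_cast at htgt
  have hl1' : (0 : ℝ) < S.lam1 := by exact_mod_cast hl1
  have hK' : eval S.KpI u u 1 ≤ (S.DpI : ℝ) := by
    have h' : 0 ≤ (S.lam1 : ℝ) * ((S.DpI : ℝ) - eval S.KpI u u 1) := by linarith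
    have := (mul_nonneg_iff_of_pos_left hl1').1 h'
    linarith
  have hbr := bridge_le S c L DK KI hlink hKI hb u u 1 hu1 hu1 h11
  have hDK' : (0 : ℝ) < DK := by exact_mod_cast hDK
  have h2B : (0 : ℝ) < 2 ^ S.B0 := pow_pos (by norm_num) _
  have hDR : (S.DpI : ℝ) * DK + S.delB ≤ (D : ℝ) * ((DK : ℝ) * 2 ^ S.B0) := by
    have h' : ((((S.DpI * DK + S.delB : ℕ) : ℚ)) : ℝ) ≤ ((D * ((DK * 2 ^ S.B0 : ℕ) : ℚ) : ℚ) : ℝ) := by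
      exact_mod_cast hD
    push_cast at h'
    exact h'
  have hDKK : (DK : ℝ) * eval S.KpI u u 1 ≤ (DK : ℝ) * (S.DpI : ℝ) :=
    mul_le_mul_of_nonneg_left hK' hDK'.le
  have key : c.kernel u u 1 * ((DK : ℝ) * 2 ^ S.B0) ≤ (D : ℝ) * ((DK : ℝ) * 2 ^ S.B0) := by
    have e1 : c.kernel u u 1 * ((DK : ℝ) * 2 ^ S.B0) = (2 ^ S.B0 : ℝ) * ((DK : ℝ) * c.kernel u u 1) := by
      ring
    rw [e1]; linarith
  have hpos : (0 : ℝ) < (DK : ℝ) * 2 ^ S.B0 := mul_pos hDK' h2B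
  exact le_of_mul_le_mul_right key hpos

/-- **A cap certificate checked by SOS identities is a cap-code bound**: with `0 < lam`,
`D < 11·lam`, the link, the kernel expansion, the seven validated Gram expansions, the bridge,
`check1`, `check2` and the side conditions, every `60°`-code of `S²` in a cap `{x : c.u₀ ≤ e·x}` has
at most eleven points. [cite: BachocVallentin2009, Theorem 4.4 (n = 3)] -/
theorem capCodeBound_of_capSOS (c : CapCert) (L : CapLink) (DK : ℕ) (KI : SPoly) (S : SOSCert)
    (g0 g1 g2 g3 g4 q0 q1 : GramBlk) (D lam : ℚ) (hlam : 0 < lam) (hD : D < 11 * lam)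
    (hlink : linkCheck c L DK = true) (hKI : CapFValid (L.blocks c.L.length c.R) KI)
    (h0 : RValid g0 S.E0) (h1 : RValid g1 S.E1) (h2 : RValid g2 S.E2) (h3 : RValid g3 S.E3)
    (h4 : RValid g4 S.E4) (hq0 : RValid q0 S.Q0) (hq1 : RValid q1 S.Q1)
    (hb : S.bridge DK KI = true) (hc1 : S.check1 = true) (hc2 : S.check2 = true)
    (hs1 : S.side1 c DK D = true) (hs2 : S.side2 c DK lam = true) :
    CapCodeBound (c.u0 : ℝ) :=
  CapCut.capCodeBound_of_capCert c D lam hlam hD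
    (ineqI_of_capSOS c L DK KI S q0 q1 D hlink hKI hq0 hq1 hb hc1 hs1)
    (ineqII_of_capSOS c L DK KI S g0 g1 g2 g3 g4 lam hlink hKI h0 h1 h2 h3 h4 hb hc2 hs2)

end Summit.Ventures.Crystal3D.CapSOS

end
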